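import Summits.CriticalPhenomena.PercolationContinuityZ3.Theorems.PercNearOneGluingNoHeavyLowerTailKnQuestion8CoefficientwiseOffCluster
import Summits.CriticalPhenomena.PercolationContinuityZ3.Theorems.PercNearOneGluingNoHeavyLowerTailKnQuestion8CoefficientwiseTrivialCoreFlip
import HarnessLib

/-!
# Two roots: the root swap of the doubly-joined mass, the ROOT-CROSS identity, and the merged-root anatomy `NO-CORE_x(y) = H_x − H_{xy} + R` — prim-lf-2 gen 50

Support file (`--supports stmt-CriticalPhenomena-4575`, closed), prover `prim-lf-2` (gen 50).  No definitions, no named facts, no sorries; standard axioms.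
Memo `prim-lf-2/CW-TWOSOURCE-gen50.md` §2, §4 (CONJECTURE NO-CORE: `prim-lf-2/CW-BOX-gen46.md`).

Setting.  Finite multigraph `ends : ι → Sym2 V`, colourings `s : Finset ι` (red) / `sᶜ` (blue); for a root `r`, `K_r(s) = openCluster (ends '' s) r`; CONJECTURE NO-CORE (gen 46) reads
`NO-CORE_x(y)[Φ] := Σ_{s : ¬(y ∈ K_x s ∧ y ∈ K_x sᶜ)} Φ(K_x s, K_x sᶜ) ≥ 0` for `Φ(a,b) = (f a − f b)(g a − g b)`, `f, g` monotone; `BOTH_x(y)[Φ] := Σ_{s : y ∈ K_x s ∧ y ∈ K_x sᶜ} Φ(K_x s, K_x sᶜ)`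
(the DOUBLY-JOINED mass), `H_r[Φ] := Σ_s Φ(K_r s, K_r sᶜ)` (Harris sum, `≥ 0`).  This generation looked at the pair of roots `x, y` together:
* `openCluster_eq_of_mem` — `y ∈ K_x(F) ⇒ K_x(F) = K_y(F)` (with gen 37's `mem_openCluster_comm`); hence on the doubly-joined colourings the red and the blue clusters of `x` and of `y` coincide and
  `both_rootSwap`: `BOTH_x(y)[Φ] = BOTH_y(x)[Φ]` for EVERY `Φ`;
* `noCore_add_both_eq_harris` — `NO-CORE_x(y)[Φ] + BOTH_x(y)[Φ] = H_x[Φ]`, so `noCore_rootPair_eq`: `NO-CORE_x(y)[Φ] + NO-CORE_y(x)[Φ] = H_x[Φ] + H_y[Φ] − 2·BOTH_x(y)[Φ]`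
  (ROOT-CROSS identity: CONJECTURE NO-CORE at both roots says `BOTH ≤ min(H_x, H_y)`; the census-clean weaker ROOT-CROSS inequality `2·BOTH ≤ H_x + H_y` is open);
* `noCore_eq_harris_sub_merged_add_twoSource` — with the MERGED root (`K_X s := K_x s ∪ K_y s`, the cluster of the set `{x,y}`):
  `NO-CORE_x(y)[Φ] = H_x[Φ] − H_{xy}[Φ] + R_{xy}[Φ]`, `H_{xy}[Φ] := Σ_s Φ(K_x s ∪ K_y s, K_x sᶜ ∪ K_y sᶜ)`, `R_{xy}[Φ] := Σ_{s : ¬(y ∈ K_x s ∧ y ∈ K_x sᶜ)} Φ(K_x s ∪ K_y s, K_x sᶜ ∪ K_y sᶜ)`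
  (the TWO-SOURCE NO-CORE); `mergedHarris_nonneg` — `H_{xy}[f,g] ≥ 0` for monotone `f, g` (Harris two-colouring for the monotone `s ↦ f(K_x s ∪ K_y s)`).
CONJECTURE R (prim-lf-2 gen 50): `R_{xy}[f,g] ≥ 0`, i.e. `BOTH_x(y) ≤ H_{x∪y}` — exact census 0 negatives for the point functions on all graphs with ≤ 6 vertices (801 120 `(G,y,{u,w})`), for
`f = 1_u` and ALL monotone `g` on ≤ 6 vertices, on the lineage's families and on 7 350 random (multi)graphs with ≤ 9 vertices; NOT implied by NO-CORE (`H_{xy} < min(H_x,H_y)` in 71 % of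
instances); its law-level shadow is NOT a corollary of conditional association ('given `x ↮ y`, `C_x ∪ C_y` is positively associated' is FALSE: 6-vertex witness at `p = 9/10`, memo §3).
[cite: KozmaNitzan2024, Questions 8–9 (§5.5 p. 36) (context: the Question-8 pocket covariance programme)]
-/

namespace Summit.CriticalPhenomena.PercolationContinuityZ3.Theorems

open Finset Literature.Probability.Percolation

namespace Coefficientwise

variable {ι V : Type*} [Fintype ι] [DecidableEq ι] (ends : ι → Sym2 V) (x y : V)

omit [Fintype ι] [DecidableEq ι] in
/-- If `y` lies in the open cluster of `x` then the two open clusters coincide (reachability is an equivalence relation).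
[cite: KozmaNitzan2024, §5.5 (context only; elementary)] -/
theorem openCluster_eq_of_mem (F : Set (Sym2 V)) {a b : V} (h : b ∈ openCluster F a) : openCluster F a = openCluster F b := by
  have h' : (openGraph F).Reachable a b := h
  ext v
  constructor
  · intro hv
    have hv' : (openGraph F).Reachable a v := hv
    exact h'.symm.trans hv'
  · intro hv
    have hv' : (openGraph F).Reachable b v := hv
    exact h'.trans hv'

open Classical in
/-- **Root swap of the doubly-joined mass.**  For EVERY `Φ`:
`Σ_{s : y ∈ K_x s ∧ y ∈ K_x sᶜ} Φ(K_x s, K_x sᶜ) = Σ_{s : x ∈ K_y s ∧ x ∈ K_y sᶜ} Φ(K_y s, K_y sᶜ)` — on these colourings `K_x s = K_y s` and `K_x sᶜ = K_y sᶜ`.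
[cite: KozmaNitzan2024, §5.5 (context only; bookkeeping)] -/
theorem both_rootSwap (Φ : Set V → Set V → ℝ) :
    ∑ s ∈ univ.filter (fun s : Finset ι => y ∈ openCluster (ends '' (↑s : Set ι)) x ∧ y ∈ openCluster (ends '' (↑(sᶜ) : Set ι)) x),
      Φ (openCluster (ends '' (↑s : Set ι)) x) (openCluster (ends '' (↑(sᶜ) : Set ι)) x) =
    ∑ s ∈ univ.filter (fun s : Finset ι => x ∈ openCluster (ends '' (↑s : Set ι)) y ∧ x ∈ openCluster (ends '' (↑(sᶜ) : Set ι)) y),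
      Φ (openCluster (ends '' (↑s : Set ι)) y) (openCluster (ends '' (↑(sᶜ) : Set ι)) y) := by
  have hfilt : univ.filter (fun s : Finset ι => y ∈ openCluster (ends '' (↑s : Set ι)) x ∧ y ∈ openCluster (ends '' (↑(sᶜ) : Set ι)) x) =
      univ.filter (fun s : Finset ι => x ∈ openCluster (ends '' (↑s : Set ι)) y ∧ x ∈ openCluster (ends '' (↑(sᶜ) : Set ι)) y) := by
    refine Finset.filter_congr fun s _ => ?_
    rw [mem_openCluster_comm ends s x y, mem_openCluster_comm ends sᶜ x y]
  rw [hfilt]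
  refine Finset.sum_congr rfl fun s hs => ?_
  obtain ⟨h1, h2⟩ := (Finset.mem_filter.mp hs).2
  rw [openCluster_eq_of_mem (ends '' (↑s : Set ι)) h1, openCluster_eq_of_mem (ends '' (↑(sᶜ) : Set ι)) h2]

open Classical in
/-- **`NO-CORE + BOTH = H`:** the colourings split by whether `y` is doubly joined to `x`.  [cite: KozmaNitzan2024, §5.5 (context only; bookkeeping)] -/
theorem noCore_add_both_eq_harris (Φ : Set V → Set V → ℝ) :
    ∑ s ∈ univ.filter (fun s : Finset ι => ¬ (y ∈ openCluster (ends '' (↑s : Set ι)) x ∧ y ∈ openCluster (ends '' (↑(sᶜ) : Set ι)) x)),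
      Φ (openCluster (ends '' (↑s : Set ι)) x) (openCluster (ends '' (↑(sᶜ) : Set ι)) x)
    + ∑ s ∈ univ.filter (fun s : Finset ι => y ∈ openCluster (ends '' (↑s : Set ι)) x ∧ y ∈ openCluster (ends '' (↑(sᶜ) : Set ι)) x),
      Φ (openCluster (ends '' (↑s : Set ι)) x) (openCluster (ends '' (↑(sᶜ) : Set ι)) x) =
    ∑ s : Finset ι, Φ (openCluster (ends '' (↑s : Set ι)) x) (openCluster (ends '' (↑(sᶜ) : Set ι)) x) := by
  rw [add_comm]
  exact Finset.sum_filter_add_sum_filter_not univ _ _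

open Classical in
/-- **ROOT-CROSS identity:** `NO-CORE_x(y)[Φ] + NO-CORE_y(x)[Φ] = H_x[Φ] + H_y[Φ] − 2·BOTH_x(y)[Φ]` for every `Φ` (`noCore_add_both_eq_harris` at both roots + `both_rootSwap`).
CONJECTURE NO-CORE at the two roots says `BOTH ≤ H_x` and `BOTH ≤ H_y`; the weaker 'ROOT-CROSS' `2·BOTH ≤ H_x + H_y` is census-clean (prim-lf-2 gen 50: points n ≤ 6 all m, n = 7 m ≤ 8;
`f = 1_u`, all monotone `g`, n ≤ 6) and open.  [cite: KozmaNitzan2024, Questions 8–9 (§5.5 p. 36) (context)] -/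
theorem noCore_rootPair_eq (Φ : Set V → Set V → ℝ) :
    ∑ s ∈ univ.filter (fun s : Finset ι => ¬ (y ∈ openCluster (ends '' (↑s : Set ι)) x ∧ y ∈ openCluster (ends '' (↑(sᶜ) : Set ι)) x)),
      Φ (openCluster (ends '' (↑s : Set ι)) x) (openCluster (ends '' (↑(sᶜ) : Set ι)) x)
    + ∑ s ∈ univ.filter (fun s : Finset ι => ¬ (x ∈ openCluster (ends '' (↑s : Set ι)) y ∧ x ∈ openCluster (ends '' (↑(sᶜ) : Set ι)) y)),
      Φ (openCluster (ends '' (↑s : Set ι)) y) (openCluster (ends '' (↑(sᶜ) : Set ι)) y) =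
    ∑ s : Finset ι, Φ (openCluster (ends '' (↑s : Set ι)) x) (openCluster (ends '' (↑(sᶜ) : Set ι)) x)
    + ∑ s : Finset ι, Φ (openCluster (ends '' (↑s : Set ι)) y) (openCluster (ends '' (↑(sᶜ) : Set ι)) y)
    - 2 * ∑ s ∈ univ.filter (fun s : Finset ι => y ∈ openCluster (ends '' (↑s : Set ι)) x ∧ y ∈ openCluster (ends '' (↑(sᶜ) : Set ι)) x),
      Φ (openCluster (ends '' (↑s : Set ι)) x) (openCluster (ends '' (↑(sᶜ) : Set ι)) x) := by
  have hx := noCore_add_both_eq_harris ends x y Φ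
  have hy := noCore_add_both_eq_harris ends y x Φ
  have hsw := both_rootSwap ends x y Φ
  linarith

open Classical in
/-- **The merged-root anatomy of NO-CORE:** with `K_X s := K_x s ∪ K_y s` (the open cluster of the SET `{x,y}`) and, for every `Φ`,
`H_{xy}[Φ] := Σ_s Φ(K_X s, K_X sᶜ)`, `R_{xy}[Φ] := Σ_{s : ¬(y ∈ K_x s ∧ y ∈ K_x sᶜ)} Φ(K_X s, K_X sᶜ)` (the TWO-SOURCE no-core sum):
`NO-CORE_x(y)[Φ] = H_x[Φ] − H_{xy}[Φ] + R_{xy}[Φ]` — on the doubly-joined colourings `K_x s ∪ K_y s = K_x s` and `K_x sᶜ ∪ K_y sᶜ = K_x sᶜ`, so `H_{xy} − R_{xy} = BOTH_x(y) = H_x − NO-CORE_x(y)`.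
CONJECTURE R (prim-lf-2 gen 50, census in the file docstring): `R_{xy}[f,g] ≥ 0` for monotone `f, g`.  [cite: KozmaNitzan2024, Questions 8–9 (§5.5 p. 36) (context)] -/
theorem noCore_eq_harris_sub_merged_add_twoSource (Φ : Set V → Set V → ℝ) :
    ∑ s ∈ univ.filter (fun s : Finset ι => ¬ (y ∈ openCluster (ends '' (↑s : Set ι)) x ∧ y ∈ openCluster (ends '' (↑(sᶜ) : Set ι)) x)),
      Φ (openCluster (ends '' (↑s : Set ι)) x) (openCluster (ends '' (↑(sᶜ) : Set ι)) x) =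
    ∑ s : Finset ι, Φ (openCluster (ends '' (↑s : Set ι)) x) (openCluster (ends '' (↑(sᶜ) : Set ι)) x)
    - ∑ s : Finset ι, Φ (openCluster (ends '' (↑s : Set ι)) x ∪ openCluster (ends '' (↑s : Set ι)) y)
        (openCluster (ends '' (↑(sᶜ) : Set ι)) x ∪ openCluster (ends '' (↑(sᶜ) : Set ι)) y)
    + ∑ s ∈ univ.filter (fun s : Finset ι => ¬ (y ∈ openCluster (ends '' (↑s : Set ι)) x ∧ y ∈ openCluster (ends '' (↑(sᶜ) : Set ι)) x)),
      Φ (openCluster (ends '' (↑s : Set ι)) x ∪ openCluster (ends '' (↑s : Set ι)) y)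
        (openCluster (ends '' (↑(sᶜ) : Set ι)) x ∪ openCluster (ends '' (↑(sᶜ) : Set ι)) y) := by
  set Kx : Finset ι → Set V := fun s => openCluster (ends '' (↑s : Set ι)) x with hKx
  set Ky : Finset ι → Set V := fun s => openCluster (ends '' (↑s : Set ι)) y with hKy
  change ∑ s ∈ univ.filter (fun s : Finset ι => ¬ (y ∈ Kx s ∧ y ∈ Kx sᶜ)), Φ (Kx s) (Kx sᶜ) =
    ∑ s : Finset ι, Φ (Kx s) (Kx sᶜ) - ∑ s : Finset ι, Φ (Kx s ∪ Ky s) (Kx sᶜ ∪ Ky sᶜ)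
    + ∑ s ∈ univ.filter (fun s : Finset ι => ¬ (y ∈ Kx s ∧ y ∈ Kx sᶜ)), Φ (Kx s ∪ Ky s) (Kx sᶜ ∪ Ky sᶜ)
  -- split both full sums by the doubly-joined filter
  have h1 := Finset.sum_filter_add_sum_filter_not univ (fun s : Finset ι => y ∈ Kx s ∧ y ∈ Kx sᶜ) (fun s => Φ (Kx s) (Kx sᶜ))
  have h2 := Finset.sum_filter_add_sum_filter_not univ (fun s : Finset ι => y ∈ Kx s ∧ y ∈ Kx sᶜ) (fun s => Φ (Kx s ∪ Ky s) (Kx sᶜ ∪ Ky sᶜ))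
  -- on the doubly-joined colourings the merged clusters are the clusters of x
  have hD : ∑ s ∈ univ.filter (fun s : Finset ι => y ∈ Kx s ∧ y ∈ Kx sᶜ), Φ (Kx s ∪ Ky s) (Kx sᶜ ∪ Ky sᶜ) =
      ∑ s ∈ univ.filter (fun s : Finset ι => y ∈ Kx s ∧ y ∈ Kx sᶜ), Φ (Kx s) (Kx sᶜ) := by
    refine Finset.sum_congr rfl fun s hs => ?_
    obtain ⟨ha, hb⟩ := (Finset.mem_filter.mp hs).2
    have e1 : Ky s = Kx s := (openCluster_eq_of_mem (ends '' (↑s : Set ι)) ha).symm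
    have e2 : Ky sᶜ = Kx sᶜ := (openCluster_eq_of_mem (ends '' (↑(sᶜ) : Set ι)) hb).symm
    rw [e1, e2, Set.union_self, Set.union_self]
  linarith

open Classical in
/-- **The merged-root Harris sum is nonnegative:** `0 ≤ H_{xy}[f,g] = Σ_s (f(K_X s) − f(K_X sᶜ))(g(K_X s) − g(K_X sᶜ))` for monotone `f, g` (`K_X s = K_x s ∪ K_y s` is monotone in `s`;
`harris_twoColouring`).  Hence, by `noCore_eq_harris_sub_merged_add_twoSource`, CONJECTURE R gives `NO-CORE_x(y) ≥ H_x − H_{xy}` (no implication either way with NO-CORE).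
[cite: KozmaNitzan2024, Questions 8–9 (§5.5 p. 36) (context)] -/
theorem mergedHarris_nonneg (f g : Set V → ℝ) (hf : Monotone f) (hg : Monotone g) :
    0 ≤ ∑ s : Finset ι,
      (f (openCluster (ends '' (↑s : Set ι)) x ∪ openCluster (ends '' (↑s : Set ι)) y) - f (openCluster (ends '' (↑(sᶜ) : Set ι)) x ∪ openCluster (ends '' (↑(sᶜ) : Set ι)) y)) *
      (g (openCluster (ends '' (↑s : Set ι)) x ∪ openCluster (ends '' (↑s : Set ι)) y) - g (openCluster (ends '' (↑(sᶜ) : Set ι)) x ∪ openCluster (ends '' (↑(sᶜ) : Set ι)) y)) := by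
  have hmono : Monotone (fun s : Finset ι => openCluster (ends '' (↑s : Set ι)) x ∪ openCluster (ends '' (↑s : Set ι)) y) :=
    fun s t hst => Set.union_subset_union (openCluster_image_mono ends hst x) (openCluster_image_mono ends hst y)
  exact harris_twoColouring (fun s : Finset ι => f (openCluster (ends '' (↑s : Set ι)) x ∪ openCluster (ends '' (↑s : Set ι)) y))
    (fun s : Finset ι => g (openCluster (ends '' (↑s : Set ι)) x ∪ openCluster (ends '' (↑s : Set ι)) y))
    (fun s t hst => hf (hmono hst)) (fun s t hst => hg (hmono hst))

end Coefficientwise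

end Summit.CriticalPhenomena.PercolationContinuityZ3.Theorems
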